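import Literature.Analysis.FluidPDE.ElgindiLinearizedOperator
import Literature.Analysis.FluidPDE.ElgindiProfileTail
import HarnessLib

/-!
# Elgindi's linearisation with angular transport: the projector `ℙ` and the operator `𝓛_Γ^T`
([Elgindi2021] Definitions 6.1–6.2, Remark 6.3, (GammaAssumption2))

Topic `Literature/Analysis/FluidPDE`. Support file (definitions with their proved API, **no
named facts**) on the proof path of the named fact
`Literature.Analysis.FluidPDE.Elgindi.ElgindiGhoulMasmoudi2021_stabilityCore`
(`ElgindiStabilityDecomposition.lean`), opening §6 "Linearization with angular transport" of
T. M. Elgindi, Ann. of Math. 194 (2021) = arXiv:1904.04795 (`[Elgindi2021]`, p. 16 of the held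
text), the operator whose `𝓗ᵏ` coercivity ([Elgindi2021] §6, Cor. 6.8/6.11, Prop. 6.13) is the
"[E_Classical]" input of Elgindi–Ghoul–Masmoudi, Camb. J. Math. 9 (2021), §3 Prop. 3.2 (there
written `𝓛^T_{F_*}`, Def. 3.1: "`𝓛^T_{F_*}f := 𝓛_{F_*}(f) + (3/(1+y))sin(2θ)∂_θf −
(Γ(θ)/c)(2z²/(1+z)³)L₁₂((3/(1+y))sin(2θ)∂_θf)(0)`").

## The printed definitions ([Elgindi2021] §6, p. 16)

* Definition 6.1: "`𝓛_Γ^T(f) = 𝓛_Γ(f) − ℙ((3/(1+z)) sin(2θ)∂_θ f)`, where `ℙ` is an operator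
  which we will now define."
* Definition 6.2: "For `f ∈ 𝓗` we define `ℙ(f)(z,θ) = f(z,θ) − (Γ(θ)/c)(2z²/(1+z)³)L₁₂(f)(0)`."
* Remark 6.3: "Note that `L₁₂(ℙ(f))(0) = 0` for every `f`."
* (GammaAssumption2): "Observe the pointwise inequality `|sin(2θ)∂_θΓ| ≤ 2αΓ`."
  (`D_θ := sin(2θ)∂_θ`, `γ = 1 + α/10`.)

(The sign of the transport term differs between [Elgindi2021] Def. 6.1, `−ℙ(…)`, and
[ElgindiGhoulMasmoudi2021] Def. 3.1, `+(3/(1+y))sin(2θ)∂_θf − …`; this file renders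
[Elgindi2021] Def. 6.1 verbatim. The two papers also normalise `F_*` differently, see
`ElgindiFundamentalModel.lean`.)

## Rendering and what is proved

`Elgindi.projP α f` and `Elgindi.opLΓT α f` on curried functions, with `Elgindi.Dθ = sin(2θ)∂_θ`
(`ElgindiWeightedSpaces.lean`), `Elgindi.opLΓ` (`ElgindiLinearizedOperator.lean`), `Elgindi.L12`.
Proved: the normalisation `∫₀^∞ 2z/(1+z)³ dz = 1` and **`L₁₂((Γ/c)·2z²/(1+z)³)(0) = 1`**
(`L12_projKernel_zero`), hence **Remark 6.3** `L₁₂(ℙf)(0) = 0` for every `f` whose `L₁₂`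
integrand is integrable on the strip (`L12_projP_zero`; for other `f` the symbol `L₁₂(f)(0)` is
Mathlib's junk `0` and the remark is void); and **(GammaAssumption2)** in the sharper form
`|sin(2θ)Γ'(θ)| ≤ (4α/3)Γ(θ) ≤ 2αΓ(θ)` on the open quarter (`abs_sin_two_mul_deriv_angularWeight_le`),
from `sin(2θ)Γ' = (2α/3)(1 − 3sin²θ)Γ` (`ElgindiProfileTail.lean`).

Not here: the coercivity statements Prop. 6.4 ff. (next files).
-/

noncomputable section

open MeasureTheory Set Function Real Filter
open _root_.Topology

namespace Literature.Analysis.FluidPDE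

namespace Elgindi

/-! ### Definition 6.2: the projector `ℙ` -/

/-- The radial–angular profile `(Γ(θ)/c)·2z²/(1+z)³` subtracted by the projector `ℙ`
(Elgindi 2021, Definition 6.2). [cite: Elgindi2021, §6 Definition 6.2 (p. 16 of arXiv:1904.04795)] -/
def projKernel (α : ℝ) (z θ : ℝ) : ℝ :=
  angularWeight α θ / profileConst α * (2 * z ^ 2 / (1 + z) ^ 3)

/-- **The projector `ℙ`** onto `{L₁₂(·)(0) = 0}`: `ℙ(f)(z,θ) = f(z,θ) −
(Γ(θ)/c)(2z²/(1+z)³)L₁₂(f)(0)` (Elgindi 2021, Definition 6.2; the same correction term appears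
in Elgindi–Ghoul–Masmoudi 2021, Def. 3.1). [cite: Elgindi2021, §6 Definition 6.2 (p. 16 of arXiv:1904.04795)] -/
def projP (α : ℝ) (f : ℝ → ℝ → ℝ) (z θ : ℝ) : ℝ :=
  f z θ - projKernel α z θ * L12 f 0

/-- Unfolding `ℙ`. [folklore] -/
theorem projP_apply (α : ℝ) (f : ℝ → ℝ → ℝ) (z θ : ℝ) :
    projP α f z θ = f z θ - angularWeight α θ / profileConst α * (2 * z ^ 2 / (1 + z) ^ 3) * L12 f 0 :=
  rfl

/-- `ℙ(f) = f` when `L₁₂(f)(0) = 0`. [folklore] -/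
theorem projP_eq_self_of_L12_zero {α : ℝ} {f : ℝ → ℝ → ℝ} (h : L12 f 0 = 0) : projP α f = f := by
  funext z θ
  simp [projP, h]

/-! ### Definition 6.1: the operator `𝓛_Γ^T` -/

/-- **The linearisation with angular transport `𝓛_Γ^T`**:
`𝓛_Γ^T(f) = 𝓛_Γ(f) − ℙ((3/(1+z)) sin(2θ)∂_θ f)` (Elgindi 2021, Definition 6.1, "acting first on
`C¹_c` functions"), with `sin(2θ)∂_θ = Elgindi.Dθ`. [cite: Elgindi2021, §6 Definition 6.1 (p. 16 of arXiv:1904.04795)]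
[cite: ElgindiGhoulMasmoudi2021, §3 Definition 3.1 (p. 10 of arXiv:1910.14071): 𝓛^T_{F_*}] -/
def opLΓT (α : ℝ) (f : ℝ → ℝ → ℝ) (z θ : ℝ) : ℝ :=
  opLΓ α f z θ - projP α (fun z' θ' => 3 / (1 + z') * Dθ f z' θ') z θ

/-- Unfolding `𝓛_Γ^T`. [folklore] -/
theorem opLΓT_apply (α : ℝ) (f : ℝ → ℝ → ℝ) (z θ : ℝ) :
    opLΓT α f z θ = opLΓ α f z θ - projP α (fun z' θ' => 3 / (1 + z') * Dθ f z' θ') z θ := rfl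

/-! ### Remark 6.3: `L₁₂(ℙ f)(0) = 0` -/

/-- `∫₀^∞ 2z/(1+z)³ dz = 1` (antiderivative `−2/(1+z) + 1/(1+z)²`). [folklore] -/
theorem integral_Ioi_two_mul_div_one_add_cube : ∫ z in Ioi (0 : ℝ), 2 * z / (1 + z) ^ 3 = 1 := by
  have hd : ∀ z ∈ Ici (0 : ℝ), HasDerivAt (fun z : ℝ => -2 * (1 + z)⁻¹ + ((1 + z) ^ 2)⁻¹)
      (2 * z / (1 + z) ^ 3) z := by
    intro z hz
    have hz1 : (1 + z) ≠ 0 := by have : (0 : ℝ) ≤ z := hz; positivity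
    have h1 : HasDerivAt (fun z : ℝ => 1 + z) 1 z := by simpa using (hasDerivAt_id' z).const_add 1
    have h2 : HasDerivAt (fun z : ℝ => (1 + z) ^ 2) (2 * (1 + z)) z := by
      simpa using h1.fun_pow 2
    have h := ((h1.fun_inv hz1).const_mul (-2)).add (h2.fun_inv (pow_ne_zero 2 hz1))
    refine h.congr_deriv ?_
    field_simp
    ring
  have ht : Tendsto (fun z : ℝ => 1 + z) atTop atTop := tendsto_atTop_add_const_left _ 1 tendsto_id
  have hl1 : Tendsto (fun z : ℝ => (1 + z)⁻¹) atTop (𝓝 0) := tendsto_inv_atTop_zero.comp ht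
  have hl2 : Tendsto (fun z : ℝ => ((1 + z) ^ 2)⁻¹) atTop (𝓝 0) :=
    tendsto_inv_atTop_zero.comp (tendsto_pow_atTop two_ne_zero |>.comp ht)
  have hl : Tendsto (fun z : ℝ => -2 * (1 + z)⁻¹ + ((1 + z) ^ 2)⁻¹) atTop (𝓝 0) := by
    simpa using (hl1.const_mul (-2)).add hl2
  rw [integral_Ioi_of_hasDerivAt_of_nonneg' hd (fun z hz => by
    have : (0 : ℝ) < z := hz; positivity) hl]
  norm_num

/-- `2z/(1+z)³` is integrable on `(0, ∞)`. [folklore] -/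
theorem integrableOn_two_mul_div_one_add_cube :
    IntegrableOn (fun z : ℝ => 2 * z / (1 + z) ^ 3) (Ioi 0) := by
  have hd : ∀ z ∈ Ici (0 : ℝ), HasDerivAt (fun z : ℝ => -2 * (1 + z)⁻¹ + ((1 + z) ^ 2)⁻¹)
      (2 * z / (1 + z) ^ 3) z := by
    intro z hz
    have hz1 : (1 + z) ≠ 0 := by have : (0 : ℝ) ≤ z := hz; positivity
    have h1 : HasDerivAt (fun z : ℝ => 1 + z) 1 z := by simpa using (hasDerivAt_id' z).const_add 1
    have h2 : HasDerivAt (fun z : ℝ => (1 + z) ^ 2) (2 * (1 + z)) z := by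
      simpa using h1.fun_pow 2
    have h := ((h1.fun_inv hz1).const_mul (-2)).add (h2.fun_inv (pow_ne_zero 2 hz1))
    refine h.congr_deriv ?_
    field_simp
    ring
  have ht : Tendsto (fun z : ℝ => 1 + z) atTop atTop := tendsto_atTop_add_const_left _ 1 tendsto_id
  have hl1 : Tendsto (fun z : ℝ => (1 + z)⁻¹) atTop (𝓝 0) := tendsto_inv_atTop_zero.comp ht
  have hl2 : Tendsto (fun z : ℝ => ((1 + z) ^ 2)⁻¹) atTop (𝓝 0) :=
    tendsto_inv_atTop_zero.comp (tendsto_pow_atTop two_ne_zero |>.comp ht)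
  have hl : Tendsto (fun z : ℝ => -2 * (1 + z)⁻¹ + ((1 + z) ^ 2)⁻¹) atTop (𝓝 0) := by
    simpa using (hl1.const_mul (-2)).add hl2
  exact integrableOn_Ioi_deriv_of_nonneg' hd (fun z hz => by
    have : (0 : ℝ) < z := hz; positivity) hl

/-- **`L₁₂((Γ/c)·2z²/(1+z)³)(0) = 1`** (`α ≥ 0`): the inner integral is `(2z/(1+z)³)·c⁻¹∫ΓK =
2z/(1+z)³`, which integrates to `1` — the normalisation that makes `ℙ` a projector onto
`{L₁₂(·)(0) = 0}` (Remark 6.3). [cite: Elgindi2021, §6 Definition 6.2 and Remark 6.3 (p. 16 of arXiv:1904.04795)] -/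
theorem L12_projKernel_zero {α : ℝ} (hα : 0 ≤ α) : L12 (projKernel α) 0 = 1 := by
  have hc : profileConst α ≠ 0 := (profileConst_pos hα).ne'
  rw [L12_def]
  have h1 : ∫ r in Ioi (0 : ℝ), ∫ θ in Ioo 0 (π / 2), projKernel α r θ * kernelK θ / r =
      ∫ r in Ioi (0 : ℝ), 2 * r / (1 + r) ^ 3 := by
    refine setIntegral_congr_fun measurableSet_Ioi fun r hr => ?_
    have hr0 : (r : ℝ) ≠ 0 := ne_of_gt hr
    have e : ∀ θ, projKernel α r θ * kernelK θ / r =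
        (2 * r / (1 + r) ^ 3 / profileConst α) * (kernelK θ * angularWeight α θ) := fun θ => by
      simp only [projKernel]
      field_simp
    simp_rw [e]
    rw [integral_const_mul, ← profileConst_eq_setIntegral]
    field_simp
  rw [h1, integral_Ioi_two_mul_div_one_add_cube]

/-- The `L₁₂` integrand of the projector profile is integrable on the strip (`α ≥ 0`). [folklore] -/
theorem integrableOn_l12Integrand_projKernel {α : ℝ} (hα : 0 ≤ α) :
    IntegrableOn (l12Integrand (projKernel α)) strip := by
  have h2 : Integrable (fun θ : ℝ => kernelK θ * angularWeight α θ / profileConst α)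
      (volume.restrict (Ioo 0 (π / 2))) := by
    have hc : Continuous fun θ : ℝ => kernelK θ * angularWeight α θ / profileConst α :=
      (continuous_kernelK_mul_angularWeight hα).div_const _
    exact (hc.integrableOn_Icc (a := 0) (b := π / 2)).mono_set Ioo_subset_Icc_self
  have h12 := (integrableOn_two_mul_div_one_add_cube).mul_prod h2
  rw [← volume_restrict_strip] at h12
  refine IntegrableOn.congr_fun h12 (fun p hp => ?_) measurableSet_strip
  have hz : p.1 ≠ 0 := ne_of_gt hp.1
  simp only [l12Integrand_apply, projKernel]
  field_simp

/-- **Remark 6.3: `L₁₂(ℙ(f))(0) = 0`** for every `f` whose `L₁₂` integrand `fK/r` is integrable on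
the strip (so that `L₁₂(f)(0)` is its integral), `α ≥ 0` (Elgindi 2021, Remark 6.3: "Note that
`L₁₂(ℙ(f))(0) = 0` for every `f`"). [cite: Elgindi2021, §6 Remark 6.3 (p. 16 of arXiv:1904.04795)] -/
theorem L12_projP_zero {α : ℝ} (hα : 0 ≤ α) {f : ℝ → ℝ → ℝ} (hf : IntegrableOn (l12Integrand f) strip) :
    L12 (projP α f) 0 = 0 := by
  have e : projP α f = f + (-L12 f 0) • projKernel α := by
    funext z θ
    simp [projP, smul_eq_mul]
    ring
  have hk : IntegrableOn (l12Integrand ((-L12 f 0) • projKernel α)) strip := by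
    have := (integrableOn_l12Integrand_projKernel hα).const_mul (-L12 f 0)
    refine IntegrableOn.congr_fun this (fun p _ => ?_) measurableSet_strip
    simp only [l12Integrand_apply, Pi.smul_apply, smul_eq_mul]
    ring
  rw [e, L12_zero_add hf hk, L12_smul, L12_projKernel_zero hα]
  ring

/-! ### (GammaAssumption2): `|sin(2θ)∂_θΓ| ≤ 2αΓ` -/

/-- **(GammaAssumption2)**, sharp form: `|sin(2θ)Γ'(θ)| ≤ (4α/3)Γ(θ)` on the open quarter
(`α ≥ 0`), from `sin(2θ)Γ' = (2α/3)(1 − 3sin²θ)Γ` and `|1 − 3sin²θ| ≤ 2` (Elgindi 2021, §6: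
"Observe the pointwise inequality `|sin(2θ)∂_θΓ| ≤ 2αΓ`"). [cite: Elgindi2021, §6 (GammaAssumption2) (p. 16 of arXiv:1904.04795)] -/
theorem abs_sin_two_mul_deriv_angularWeight_le {α : ℝ} (hα : 0 ≤ α) {θ : ℝ} (hθ : θ ∈ Ioo 0 (π / 2)) :
    |Real.sin (2 * θ) * deriv (angularWeight α) θ| ≤ 4 * α / 3 * angularWeight α θ := by
  rw [sin_two_mul_mul_deriv_angularWeight α hθ]
  have hΓ : 0 ≤ angularWeight α θ := angularWeight_nonneg α (Ioo_subset_Icc_self hθ)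
  have hs : Real.sin θ ^ 2 ≤ 1 := by nlinarith [Real.sin_sq_le_one θ]
  have hb : |1 - 3 * Real.sin θ ^ 2| ≤ 2 := by
    rw [abs_le]
    constructor <;> nlinarith [sq_nonneg (Real.sin θ)]
  rw [abs_mul, abs_mul, abs_of_nonneg hΓ, abs_of_nonneg (by positivity : (0 : ℝ) ≤ 2 * α / 3)]
  calc 2 * α / 3 * |1 - 3 * Real.sin θ ^ 2| * angularWeight α θ
      ≤ 2 * α / 3 * 2 * angularWeight α θ := by
        apply mul_le_mul_of_nonneg_right _ hΓ
        exact mul_le_mul_of_nonneg_left hb (by positivity)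
    _ = 4 * α / 3 * angularWeight α θ := by ring

/-- **(GammaAssumption2) as printed**: `|sin(2θ)∂_θΓ| ≤ 2αΓ` on the open quarter (`α ≥ 0`);
`|D_θ Γ| ≤ 2αΓ` with `D_θ = sin(2θ)∂_θ`. [cite: Elgindi2021, §6 (GammaAssumption2) (p. 16 of arXiv:1904.04795)] -/
theorem abs_Dθ_angularWeight_le {α : ℝ} (hα : 0 ≤ α) {θ : ℝ} (hθ : θ ∈ Ioo 0 (π / 2)) :
    |Real.sin (2 * θ) * deriv (angularWeight α) θ| ≤ 2 * α * angularWeight α θ := by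
  have h := abs_sin_two_mul_deriv_angularWeight_le hα hθ
  have hΓ : 0 ≤ angularWeight α θ := angularWeight_nonneg α (Ioo_subset_Icc_self hθ)
  nlinarith

end Elgindi

end Literature.Analysis.FluidPDE
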